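import Summits.NavierStokesRegularity.NavierStokesRegularity.Theorems.FilamentSkeletonRssRdssProfileTruncationSmoothRepresentative
import HarnessLib

/-!
# Route CorkscrewDynamo · crux `CorkscrewProfile` (stmt-NavierStokesRegularity-11282) — the SHARP smooth representative

registered tools stub `stub_sharpRepresentative`: a Type-I rotated-DSS ancient mild
solution `u` (duality form, measurable slices, `IsRotatedDSS c R u`, `HasTypeIDecay C₀ u`) has an Oseen-gauge representative
`V`, `IsTypeIAncientMild C₀ V`, rotated DSS with the SAME `(c, R)`, Type I with the SAME `C₀`, zero on `t ≥ 0`, and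
`∀ t < 0, V t =ᵐ u t` — a sharpening of the tree's `stub_rdssSmoothRepresentative` (same construction, re-run; the
slice-wise link for EVERY `t < 0` by weak-* continuity of both fields). Consumers: `CorkscrewDynamoCorkscrewProfileNormalForm`.
-/

noncomputable section

open MeasureTheory Set Filter Topology Function Metric
open Literature.Analysis.FluidPDE Literature.Analysis
open scoped RealInnerProductSpace ENNReal

namespace Summit.NavierStokesRegularity.NavierStokesRegularity.Theorems.CorkscrewProfile.Birth

set_option linter.dupNamespace false

/-- From `‖v‖ ≤ C₀ / D` and `r ≤ D`, `0 < D`: `r ‖v‖ ≤ C₀`. [folklore] -/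
private theorem csRepr_bounds {C₀ D r : ℝ} {v : (EuclideanSpace ℝ (Fin 3))} (h : ‖v‖ ≤ C₀ / D) (hrD : r ≤ D)
    (hD : 0 < D) : r * ‖v‖ ≤ C₀ :=
  calc r * ‖v‖ ≤ D * ‖v‖ := mul_le_mul_of_nonneg_right hrD (norm_nonneg _)
    _ ≤ D * (C₀ / D) := mul_le_mul_of_nonneg_left h hD.le
    _ = C₀ := mul_div_cancel₀ _ hD.ne'

/-- Under the Type-I bound, the translate `f(· + b)`, `b < 0`, is bounded by `C₀/√(−b)` on `t < 0`
and has the decay `r‖f‖ ≤ C₀` (`r ≤ ‖x‖` the cylindrical radius). [folklore] -/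
private theorem csRepr_translate {f : ℝ → (EuclideanSpace ℝ (Fin 3)) → (EuclideanSpace ℝ (Fin 3))} {C₀ : ℝ}
    (hf : ∀ t < 0, ∀ x, ‖f t x‖ ≤ C₀ / (‖x‖ + √(-t))) {b : ℝ} (hb : b < 0) {s : ℝ}
    (hs : s < 0) (x : (EuclideanSpace ℝ (Fin 3))) :
    ‖f (s + b) x‖ ≤ C₀ / √(-b) ∧ cylRadius x * ‖f (s + b) x‖ ≤ C₀ := by
  have h := hf (s + b) (by linarith) x
  have hr : 0 < √(-b) := Real.sqrt_pos.2 (neg_pos.2 hb)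
  have hrD : √(-b) ≤ ‖x‖ + √(-(s + b)) :=
    le_add_of_nonneg_of_le (norm_nonneg _) (Real.sqrt_le_sqrt (by linarith))
  have hD : 0 < ‖x‖ + √(-(s + b)) := hr.trans_le hrD
  have hcyl : cylRadius x ≤ ‖x‖ := by
    rw [cylRadius, EuclideanSpace.norm_eq, Fin.sum_univ_three]
    refine Real.sqrt_le_sqrt ?_
    simp only [Real.norm_eq_abs, sq_abs]
    nlinarith [sq_nonneg (x 2)]
  exact ⟨(le_div_iff₀' hr).2 (csRepr_bounds h hrD hD),
    csRepr_bounds h (hcyl.trans (le_add_of_nonneg_right (Real.sqrt_nonneg _))) hD⟩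

/-- **Weak-* continuity in time** of a Type-I ancient mild solution (duality form): near `t₀ < 0` use the bounded
translate `u(· + t₀/2)` and `continuousOn_integral_inner_of_cylRadius_decay`. [folklore] -/
private theorem csRepr_weakStar {u : ℝ → (EuclideanSpace ℝ (Fin 3)) → (EuclideanSpace ℝ (Fin 3))} {C₀ : ℝ}
    (hu : IsAncientMildSolution 1 u)
    (hmeas : ∀ t < 0, AEStronglyMeasurable (u t) volume) (hC : HasTypeIDecay C₀ u)
    {θ : (EuclideanSpace ℝ (Fin 3)) → (EuclideanSpace ℝ (Fin 3))}
    (hθ : FunctionSpaces.IsTestFunctionOn (⊤ : TopologicalSpace.Opens (EuclideanSpace ℝ (Fin 3))) θ) :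
    ContinuousOn (fun t => ∫ x, ⟪u t x, θ x⟫) (Iio 0) := by
  intro t₀ ht₀
  obtain ⟨b, hb0, hbt⟩ : ∃ b : ℝ, b < 0 ∧ t₀ < b :=
    ⟨t₀ / 2, by linarith [mem_Iio.1 ht₀], by linarith [mem_Iio.1 ht₀]⟩
  have hbd := fun s (hs : s < 0) x => csRepr_translate hC hb0 hs x
  have hmb : ∀ s < 0, AEStronglyMeasurable (u (s + b)) volume := fun s hs => hmeas _ (by linarith)
  have hub : IsBoundedAncientMildSolution 1 (fun s => u (s + b)) :=
    ⟨hu.time_translate hb0.le, C₀ / √(-b), fun s hs x => (hbd s hs x).1⟩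
  have key := continuousOn_integral_inner_of_cylRadius_decay (u := fun s => u (s + b))
    (fun s hs x => (hbd s hs x).1) hmb (fun s hs => hu.1 _ (by linarith))
    (fun φ hφ hdiv => hub.continuousOn_integral_inner one_pos hmb hφ hdiv)
    (fun s hs x => (hbd s hs x).2) hθ
  have h3 := (key.continuousAt (Iio_mem_nhds (by linarith))).comp_of_eq
    (continuous_sub_right b).continuousAt rfl
  refine (h3.congr (Eventually.of_forall fun t => ?_)).continuousWithinAt
  simp only [comp_apply, sub_add_cancel]

/-- **A jointly measurable modification with the Type-I bound everywhere** (modify the bounded weak-* continuous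
family `√(−t) u(t)` by `exists_stronglyMeasurable_modification`, divide by `√(−t)`, clamp to the Type-I bound). [folklore] -/
private theorem csRepr_modification {u : ℝ → (EuclideanSpace ℝ (Fin 3)) → (EuclideanSpace ℝ (Fin 3))} {C₀ : ℝ} (hC₀ : 0 ≤ C₀)
    (hmeas : ∀ t < 0, AEStronglyMeasurable (u t) volume) (hC : HasTypeIDecay C₀ u)
    (hws : ∀ θ : (EuclideanSpace ℝ (Fin 3)) → (EuclideanSpace ℝ (Fin 3)),
      FunctionSpaces.IsTestFunctionOn (⊤ : TopologicalSpace.Opens (EuclideanSpace ℝ (Fin 3))) θ →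
      ContinuousOn (fun t => ∫ x, ⟪u t x, θ x⟫) (Iio 0)) :
    ∃ w : ℝ → (EuclideanSpace ℝ (Fin 3)) → (EuclideanSpace ℝ (Fin 3)), StronglyMeasurable (uncurry w) ∧
      (∀ t < 0, w t =ᵐ[volume] u t) ∧
      ∀ t < 0, ∀ x, ‖w t x‖ ≤ C₀ / (‖x‖ + √(-t)) := by
  have hM : ∀ t < 0, ∀ x, ‖√(-t) • u t x‖ ≤ C₀ := fun t ht x => by
    rw [norm_smul, Real.norm_of_nonneg (Real.sqrt_nonneg _)]
    exact csRepr_bounds (hC t ht x) (le_add_of_nonneg_left (norm_nonneg _))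
      (add_pos_of_nonneg_of_pos (norm_nonneg _) (Real.sqrt_pos.2 (neg_pos.2 ht)))
  obtain ⟨w₀, hw₀m, hw₀u⟩ := exists_stronglyMeasurable_modification
    (u := fun t x => √(-t) • u t x) hM (fun t ht => (hmeas t ht).const_smul (√(-t)))
    fun θ hθ => ((Real.continuous_sqrt.comp continuous_neg).continuousOn.mul (hws θ hθ)).congr
      fun t _ => by simp only [Pi.mul_apply, comp_apply, real_inner_smul_left, integral_const_mul]
  have h1 : StronglyMeasurable fun z : ℝ × (EuclideanSpace ℝ (Fin 3)) => (√(-z.1))⁻¹ • w₀ z.1 z.2 :=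
    measurable_fst.neg.sqrt.inv.stronglyMeasurable.smul hw₀m
  have h2 : MeasurableSet {z : ℝ × (EuclideanSpace ℝ (Fin 3)) | ‖(√(-z.1))⁻¹ • w₀ z.1 z.2‖ ≤ C₀ / (‖z.2‖ + √(-z.1))} :=
    measurableSet_le h1.measurable.norm
      (measurable_const.div (measurable_snd.norm.add measurable_fst.neg.sqrt))
  set w : ℝ → (EuclideanSpace ℝ (Fin 3)) → (EuclideanSpace ℝ (Fin 3)) := fun t x => if ‖(√(-t))⁻¹ • w₀ t x‖ ≤ C₀ / (‖x‖ + √(-t))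
    then (√(-t))⁻¹ • w₀ t x else 0 with hw
  refine ⟨w, StronglyMeasurable.ite h2 h1 stronglyMeasurable_const, fun t ht => ?_,
    fun t ht x => ?_⟩
  · filter_upwards [hw₀u t ht] with x hx
    have e : (√(-t))⁻¹ • w₀ t x = u t x := by
      rw [hx, smul_smul, inv_mul_cancel₀ (Real.sqrt_pos.2 (neg_pos.2 ht)).ne', one_smul]
    simp only [hw]
    rw [if_pos (by rw [e]; exact hC t ht x), e]
  · simp only [hw]
    split_ifs with h
    · exact h
    · rw [norm_zero]; positivity

/-- **The Morrey bound from the Type-I bound**: `‖w(t, y)‖ ≤ C₀/‖y‖` gives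
`∫_{B_m(0)} ‖w(t)‖² ≤ C₀² ∫_{B_m} |y|^{-2} = 3|B₁| C₀² m`. [folklore] -/
private theorem csRepr_morrey {w : ℝ → (EuclideanSpace ℝ (Fin 3)) → (EuclideanSpace ℝ (Fin 3))} {C₀ : ℝ}
    (hwb : ∀ t < 0, ∀ x, ‖w t x‖ ≤ C₀ / (‖x‖ + √(-t))) {t : ℝ} (ht : t < 0) {m : ℕ}
    (hm : 1 ≤ m) : ∫⁻ y in ball (0 : (EuclideanSpace ℝ (Fin 3))) m, ‖w t y‖ₑ ^ 2 ≤
      ENNReal.ofReal (C₀ ^ 2 * (3 * (volume : Measure (EuclideanSpace ℝ (Fin 3))).real (ball 0 1)) * m) := by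
  have hm0 : (0 : ℝ) < m := by exact_mod_cast hm
  have hpt : ∀ᵐ y ∂(volume.restrict (ball (0 : (EuclideanSpace ℝ (Fin 3))) m)),
      ‖w t y‖ₑ ^ 2 ≤ ENNReal.ofReal (C₀ ^ 2) * ENNReal.ofReal (‖y‖ ^ (-(2 : ℝ))) := by
    refine (ae_restrict_of_ae (measure_eq_zero_iff_ae_notMem.1 (measure_singleton (0 : (EuclideanSpace ℝ (Fin 3)))))).mono
      fun y hy => ?_
    have hy0 : 0 < ‖y‖ := norm_pos_iff.2 hy
    have h1 : ‖w t y‖ ≤ C₀ / ‖y‖ := (le_div_iff₀' hy0).2 (csRepr_bounds (hwb t ht y)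
      (le_add_of_nonneg_right (Real.sqrt_nonneg _)) (by positivity))
    have h2 : ‖w t y‖ ^ 2 ≤ C₀ ^ 2 * ‖y‖ ^ (-(2 : ℝ)) := by
      rw [Real.rpow_neg hy0.le, Real.rpow_two, ← div_eq_mul_inv, ← div_pow]
      exact pow_le_pow_left₀ (norm_nonneg _) h1 2
    rw [← ENNReal.ofReal_mul (sq_nonneg _), ← ofReal_norm, ← ENNReal.ofReal_pow (norm_nonneg _)]
    exact ENNReal.ofReal_le_ofReal h2
  refine (lintegral_mono_ae hpt).trans_eq ?_
  rw [lintegral_const_mul' _ _ ENNReal.ofReal_ne_top,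
    NewtonPotentialHolder.lintegral_ball_norm_rpow_neg (by norm_num) hm0,
    ← ENNReal.ofReal_mul (sq_nonneg _)]
  congr 1
  norm_num
  ring

/-- Transport of an a.e. statement on a set along a null-set preserving map. [folklore] -/
private theorem csRepr_ae_comp {α : Type*} [MeasurableSpace α] {μ : Measure α} {f : α → α}
    (hf : Measure.QuasiMeasurePreserving f μ μ) {s s' : Set α} (hs : MeasurableSet s)
    (hs' : MeasurableSet s') (hmaps : MapsTo f s s') {p : α → Prop}
    (h : ∀ᵐ z ∂(μ.restrict s'), p z) : ∀ᵐ z ∂(μ.restrict s), p (f z) := by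
  rw [ae_restrict_iff' hs'] at h
  rw [ae_restrict_iff' hs]
  exact (hf.ae h).mono fun z hz hzs => hz (hmaps hzs)

/-- **Registered tools stub `stub_sharpRepresentative` — the sharp smooth representative** of a Type-I rotated-DSS
ancient mild solution (duality form): Oseen gauge `IsTypeIAncientMild C₀ V`, same `(c, R)`, same `C₀`, zero on `t ≥ 0`,
`V t = u t` a.e. for every `t < 0` (modification,
KNSS windows, gluing, Prop. 4.1, pointwise RDSS; then the weak-* continuous pairings of `u` and `V` agree for a.e. `t`,
hence for all `t < 0`, and du Bois-Reymond). [cite: KochNadirashviliSereginSverak2009, §4 and Thm 5.3] -/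
theorem stub_sharpRepresentative :
    ∀ (c : ℝ) (R : EuclideanSpace ℝ (Fin 3) ≃ₗᵢ[ℝ] EuclideanSpace ℝ (Fin 3))
      (u : ℝ → EuclideanSpace ℝ (Fin 3) → EuclideanSpace ℝ (Fin 3)) (C₀ : ℝ), 0 < c →
      Literature.Analysis.FluidPDE.IsAncientMildSolution 1 u → (∀ t < 0, AEStronglyMeasurable (u t) volume) →
      Literature.Analysis.FluidPDE.IsRotatedDSS c R u → Literature.Analysis.FluidPDE.HasTypeIDecay C₀ u →
      ∃ V : ℝ → EuclideanSpace ℝ (Fin 3) → EuclideanSpace ℝ (Fin 3),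
        Literature.Analysis.FluidPDE.IsTypeIAncientMild C₀ V ∧ Literature.Analysis.FluidPDE.IsRotatedDSS c R V ∧
        Literature.Analysis.FluidPDE.HasTypeIDecay C₀ V ∧ (∀ t < 0, V t =ᵐ[volume] u t) ∧
        (∀ t, 0 ≤ t → ∀ x, V t x = 0) := by
  intro c R u C₀ hc hu hmeas hdss hC
  have hC₀ : 0 ≤ C₀ := by simpa using (norm_nonneg _).trans (hC (-1) (by norm_num) 0)
  have hws := fun θ hθ => csRepr_weakStar hu hmeas hC (θ := θ) hθ
  obtain ⟨w, hsm, hwu, hwb⟩ := csRepr_modification hC₀ hmeas hC hws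
  have hS : MeasurableSet (Iio (0 : ℝ) ×ˢ (univ : Set (EuclideanSpace ℝ (Fin 3)))) := measurableSet_Iio.prod .univ
  -- ## Step 2: the translates `w(· + b)`, `b < 0`, are bounded weak solutions of KNSS
  have hbw : ∀ b < 0, IsBoundedWeakNSSolutionOn (Iio 0) isOpen_Iio 1 (fun t => w (t + b)) := by
    intro b hb
    have hub : IsBoundedAncientMildSolution 1 (fun t => u (t + b)) := ⟨hu.time_translate hb.le,
      C₀ / √(-b), fun t ht x => (csRepr_translate hC hb (mem_Iio.1 ht) x).1⟩
    exact (hub.congr_ae_slice (fun t ht => hwu (t + b) (by linarith)) ⟨C₀ / √(-b),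
      fun t ht x => (csRepr_translate hwb hb (mem_Iio.1 ht) x).1⟩).isBoundedWeakNSSolutionOn
      one_pos (hsm.comp_measurable ((measurable_fst.add_const b).prodMk
        measurable_snd)).aestronglyMeasurable
      fun t ht => (hmeas (t + b) (by linarith)).congr (hwu (t + b) (by linarith)).symm
  -- ## window representatives on `W_n = (a, d)`, `a = -(n+2)`, `d = -(n+2)⁻¹`
  have hwin : ∀ n : ℕ, ∃ v : ℝ → (EuclideanSpace ℝ (Fin 3)) → (EuclideanSpace ℝ (Fin 3)),
      ContinuousOn (uncurry v) (Ioo (-(n + 2 : ℝ)) (-(n + 2 : ℝ)⁻¹) ×ˢ univ) ∧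
      (∀ t ∈ Ioo (-(n + 2 : ℝ)) (-(n + 2 : ℝ)⁻¹), IsWeaklyDivFree (v t)) ∧
      (∀ s t : ℝ, s ∈ Ioo (-(n + 2 : ℝ)) (-(n + 2 : ℝ)⁻¹) →
        t ∈ Ioo (-(n + 2 : ℝ)) (-(n + 2 : ℝ)⁻¹) → s < t → ∀ x,
        v t x = UnboundedOperators.heatExtension (v s) (t - s) x - oseenDuhamel 1 s v v t x) ∧
      ∀ᵐ z ∂(volume.restrict (Ioo (-(n + 2 : ℝ)) (-(n + 2 : ℝ)⁻¹) ×ˢ (univ : Set (EuclideanSpace ℝ (Fin 3))))),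
        uncurry w z = uncurry v z := by
    intro n
    have hd : -(n + 2 : ℝ)⁻¹ < 0 := neg_neg_of_pos (inv_pos.2 (by positivity))
    have had : -(n + 2 : ℝ) < -(n + 2 : ℝ)⁻¹ := by
      linarith [inv_lt_one_of_one_lt₀ (by linarith [n.cast_nonneg (α := ℝ)] : (1 : ℝ) < n + 2)]
    set d : ℝ := -(n + 2 : ℝ)⁻¹
    set a : ℝ := -(n + 2 : ℝ)
    -- `w(· + a)` is a bounded weak solution on `(0, d - a)`, bounded, with the Morrey bound
    have hJI : ∀ τ : ℝ, τ ∈ Ioo 0 (d - a) ↔ τ + (a - d) ∈ Ioo (a - d) 0 := fun τ =>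
      ⟨fun h => ⟨by linarith [h.1], by linarith [h.2]⟩, fun h => ⟨by linarith [h.1], by
        linarith [h.2]⟩⟩
    have hbw' : IsBoundedWeakNSSolutionOn (Ioo 0 (d - a)) isOpen_Ioo 1 (fun τ => w (τ + a)) := by
      convert ((hbw d hd).mono isOpen_Ioo Ioo_subset_Iio_self).comp_add_right (a - d) isOpen_Ioo
        hJI using 2
      simp only [add_assoc, sub_add_cancel]
    have hM : ∀ τ ∈ Ioo 0 (d - a), ∀ x, ‖w (τ + a) x‖ ≤ C₀ / √(-d) := fun τ hτ x => by
      have h := (csRepr_translate hwb hd (s := τ + a - d) (by linarith [hτ.2]) x).1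
      rwa [sub_add_cancel] at h
    have hMor : ∀ᵐ τ ∂(volume.restrict (Ioo 0 (d - a))), ∀ m : ℕ, 1 ≤ m →
        ∫⁻ y in ball (0 : (EuclideanSpace ℝ (Fin 3))) m, ‖w (τ + a) y‖ₑ ^ 2 ≤
          ENNReal.ofReal (C₀ ^ 2 * (3 * (volume : Measure (EuclideanSpace ℝ (Fin 3))).real (ball 0 1)) * m) :=
      (ae_restrict_mem measurableSet_Ioo).mono fun τ hτ m hm =>
        csRepr_morrey hwb (by linarith [hτ.2]) hm
    obtain ⟨v, hvc, hvd, hvm, hvae⟩ := HardyAncientLimit.exists_oseenMild_repr_of_boundedWeak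
      (sub_pos.2 had) hbw' hM (by positivity) hMor
    -- translate back
    refine ⟨fun t x => v (t - a) x, ?_, fun t ht => hvd (t - a) ⟨by linarith [ht.1], by
      linarith [ht.2]⟩, fun s t hs ht hst x => ?_, ?_⟩
    · exact hvc.comp (f := fun q : ℝ × (EuclideanSpace ℝ (Fin 3)) => (q.1 - a, q.2))
        ((continuous_fst.sub continuous_const).prodMk continuous_snd).continuousOn fun q hq =>
        ⟨⟨sub_pos.2 hq.1.1, by linarith [hq.1.2]⟩, mem_univ _⟩
    · have h1 := hvm (s - a) (t - a) (by linarith [hs.1]) (by linarith) (by linarith [ht.2]) x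
      rw [show t - a - (s - a) = t - s by ring] at h1
      show v (t - a) x = UnboundedOperators.heatExtension (v (s - a)) (t - s) x -
        oseenDuhamel 1 s (fun τ => v (τ - a)) (fun τ => v (τ - a)) t x
      rwa [oseenDuhamel_comp_sub_right]
    · have hq : Measure.QuasiMeasurePreserving (Prod.map (fun t : ℝ => t - a) (id : (EuclideanSpace ℝ (Fin 3)) → (EuclideanSpace ℝ (Fin 3))))
          (volume : Measure (ℝ × (EuclideanSpace ℝ (Fin 3)))) volume := by
        rw [Measure.volume_eq_prod]
        exact ((measurePreserving_sub_right (volume : Measure ℝ) a).prod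
          (MeasurePreserving.id (volume : Measure (EuclideanSpace ℝ (Fin 3))))).quasiMeasurePreserving
      have hmaps : MapsTo (Prod.map (fun t : ℝ => t - a) (id : (EuclideanSpace ℝ (Fin 3)) → (EuclideanSpace ℝ (Fin 3)))) (Ioo a d ×ˢ univ)
          (Ioo 0 (d - a) ×ˢ univ) := fun z hz =>
        ⟨⟨by show 0 < z.1 - a; linarith [hz.1.1], by show z.1 - a < d - a; linarith [hz.1.2]⟩,
          mem_univ _⟩
      refine (csRepr_ae_comp hq (measurableSet_Ioo.prod MeasurableSet.univ)
        (measurableSet_Ioo.prod MeasurableSet.univ) hmaps hvae).mono fun z hz => ?_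
      have hz' : w (z.1 - a + a) z.2 = v (z.1 - a) z.2 := hz
      rwa [sub_add_cancel] at hz'
  -- ## Step 3: gluing the window representatives
  choose v hvc hvd hvm hvae using hwin
  have hW0 : ∀ n : ℕ, ∀ t ∈ Ioo (-(n + 2 : ℝ)) (-(n + 2 : ℝ)⁻¹), t < 0 := fun n t ht =>
    ht.2.trans (neg_neg_of_pos (inv_pos.2 (by positivity)))
  have hW2 : ∀ s t : ℝ, s ≤ t → t < 0 → ∃ m : ℕ,
      s ∈ Ioo (-(m + 2 : ℝ)) (-(m + 2 : ℝ)⁻¹) ∧ t ∈ Ioo (-(m + 2 : ℝ)) (-(m + 2 : ℝ)⁻¹) := by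
    intro s t hst ht
    obtain ⟨m, hm⟩ := exists_nat_ge (max (-s) (-t)⁻¹)
    have h1 : -s ≤ m := (le_max_left _ _).trans hm
    have h2 : ((m : ℝ) + 2)⁻¹ < -t :=
      inv_lt_of_inv_lt₀ (neg_pos.2 ht) (by linarith [(le_max_right _ _).trans hm])
    exact ⟨m, ⟨by linarith, by linarith⟩, ⟨by linarith, by linarith⟩⟩
  have hW1 : ∀ t : ℝ, ∃ m : ℕ, t < 0 → t ∈ Ioo (-(m + 2 : ℝ)) (-(m + 2 : ℝ)⁻¹) := fun t => by
    by_cases ht : t < 0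
    · exact (hW2 t t le_rfl ht).imp fun m hm _ => hm.1
    · exact ⟨0, fun h => absurd h ht⟩
  choose N hN using hW1
  -- two window representatives agree on the overlap (continuous, a.e. equal to `w`)
  have hagree : ∀ k n, EqOn (uncurry (v k)) (uncurry (v n))
      ((Ioo (-(k + 2 : ℝ)) (-(k + 2 : ℝ)⁻¹) ∩ Ioo (-(n + 2 : ℝ)) (-(n + 2 : ℝ)⁻¹)) ×ˢ univ) := by
    intro k n
    refine Measure.eqOn_open_of_ae_eq (μ := (volume : Measure (ℝ × (EuclideanSpace ℝ (Fin 3))))) ?_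
      ((isOpen_Ioo.inter isOpen_Ioo).prod isOpen_univ)
      ((hvc k).mono (prod_mono inter_subset_left Subset.rfl))
      ((hvc n).mono (prod_mono inter_subset_right Subset.rfl))
    filter_upwards [ae_restrict_of_ae_restrict_of_subset (prod_mono inter_subset_left Subset.rfl)
      (hvae k), ae_restrict_of_ae_restrict_of_subset (prod_mono inter_subset_right Subset.rfl)
      (hvae n)] with z hz1 hz2
    rw [← hz1, ← hz2]
  set V : ℝ → (EuclideanSpace ℝ (Fin 3)) → (EuclideanSpace ℝ (Fin 3)) := fun t x => if t < 0 then v (N t) t x else 0 with hV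
  have hV0 : ∀ t, 0 ≤ t → ∀ x, V t x = 0 := fun t ht x => by simp only [hV, if_neg (not_lt.2 ht)]
  have hloc : ∀ n : ℕ, ∀ t ∈ Ioo (-(n + 2 : ℝ)) (-(n + 2 : ℝ)⁻¹), ∀ x, V t x = v n t x :=
    fun n t ht x => by
    simp only [hV, if_pos (hW0 n t ht)]
    exact hagree (N t) n (x := (t, x)) ⟨⟨hN t (hW0 n t ht), ht⟩, mem_univ _⟩
  have hcont : ContinuousOn (uncurry V) (Iio 0 ×ˢ univ) := by
    rintro ⟨t, x⟩ ⟨ht, -⟩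
    exact (((hvc (N t)).congr fun z hz => hloc (N t) z.1 hz.1 z.2).continuousAt
      ((isOpen_Ioo.prod isOpen_univ).mem_nhds ⟨hN t ht, mem_univ _⟩)).continuousWithinAt
  have hae : ∀ᵐ z ∂(volume.restrict (Iio (0 : ℝ) ×ˢ (univ : Set (EuclideanSpace ℝ (Fin 3))))),
      uncurry w z = uncurry V z := by
    have hcover : Iio (0 : ℝ) ×ˢ (univ : Set (EuclideanSpace ℝ (Fin 3))) ⊆
        ⋃ n : ℕ, Ioo (-(n + 2 : ℝ)) (-(n + 2 : ℝ)⁻¹) ×ˢ (univ : Set (EuclideanSpace ℝ (Fin 3))) :=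
      fun z hz => mem_iUnion.2 ⟨N z.1, hN z.1 hz.1, mem_univ _⟩
    refine ae_restrict_of_ae_restrict_of_subset hcover ((ae_restrict_iUnion_iff _ _).2 fun n => ?_)
    filter_upwards [hvae n, ae_restrict_mem (measurableSet_Ioo.prod MeasurableSet.univ)]
      with z hz hzI
    exact hz.trans (hloc n z.1 hzI.1 z.2).symm
  have hdiv : ∀ t < 0, IsWeaklyDivFree (V t) := fun t ht => by
    rw [show V t = v (N t) t from funext fun x => hloc (N t) t (hN t ht) x]
    exact hvd (N t) t (hN t ht)
  have hmild : ∀ s t : ℝ, s < t → t < 0 → ∀ x,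
      V t x = UnboundedOperators.heatExtension (V s) (t - s) x - oseenDuhamel 1 s V V t x := by
    intro s t hst ht x
    obtain ⟨m, hs, ht'⟩ := hW2 s t hst.le ht
    rw [hloc m t ht' x, show V s = v m s from funext (hloc m s hs),
      oseenDuhamel_congr_Ioo (a' := v m) (b' := v m)
        (fun σ hσ => funext (hloc m σ ⟨hs.1.trans hσ.1, hσ.2.trans ht'.2⟩))
        (fun σ hσ => funext (hloc m σ ⟨hs.1.trans hσ.1, hσ.2.trans ht'.2⟩)) x]
    exact hvm m s t hs ht' hst x
  -- the Type I bound passes from `w` (everywhere) to the continuous representative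
  have hdec : HasTypeIDecay C₀ V := by
    have hb : ContinuousOn (fun z : ℝ × (EuclideanSpace ℝ (Fin 3)) => C₀ / (‖z.2‖ + √(-z.1)))
        (Iio (0 : ℝ) ×ˢ (univ : Set (EuclideanSpace ℝ (Fin 3)))) :=
      continuousOn_const.div
        (continuous_snd.norm.add (Real.continuous_sqrt.comp continuous_fst.neg)).continuousOn
        fun z hz => (add_pos_of_nonneg_of_pos (norm_nonneg _)
          (Real.sqrt_pos.2 (neg_pos.2 hz.1))).ne'
    have hn : ContinuousOn (fun z : ℝ × (EuclideanSpace ℝ (Fin 3)) => ‖V z.1 z.2‖) (Iio (0 : ℝ) ×ˢ (univ : Set (EuclideanSpace ℝ (Fin 3)))) :=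
      hcont.norm
    have hEq := Measure.eqOn_open_of_ae_eq (μ := (volume : Measure (ℝ × (EuclideanSpace ℝ (Fin 3)))))
      (f := fun z : ℝ × (EuclideanSpace ℝ (Fin 3)) => min ‖V z.1 z.2‖ (C₀ / (‖z.2‖ + √(-z.1)))) ?_
      (isOpen_Iio.prod isOpen_univ) (continuous_min.comp_continuousOn (hn.prodMk hb)) hn
    · exact fun t ht x => min_eq_left_iff.1 (hEq (x := (t, x)) ⟨ht, mem_univ _⟩)
    · filter_upwards [hae, ae_restrict_mem hS] with z hz hzS
      rw [← show w z.1 z.2 = V z.1 z.2 from hz]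
      exact min_eq_left (hwb z.1 hzS.1 z.2)
  have hT : IsTypeIAncientMild C₀ V :=
    isTypeIAncientMild_of_continuous_oseenMild hcont hdiv hmild (hdec.hasTypeITimeDecay hC₀)
  -- ## Step 4: rotated discrete self-similarity: a.e. (null sets are preserved), then pointwise
  have hR : IsRotatedDSS c R V := by
    have hc2 : 0 < c ^ 2 := by positivity
    have hq₁ : Measure.QuasiMeasurePreserving (fun x : (EuclideanSpace ℝ (Fin 3)) => c • R x) volume volume :=
      (Measure.quasiMeasurePreserving_smul volume hc.ne').comp
        R.measurePreserving.quasiMeasurePreserving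
    have hqΦ : Measure.QuasiMeasurePreserving
        (Prod.map (fun t : ℝ => c ^ 2 * t) (fun x : (EuclideanSpace ℝ (Fin 3)) => c • R x))
        (volume : Measure (ℝ × (EuclideanSpace ℝ (Fin 3)))) volume := by
      rw [Measure.volume_eq_prod]
      exact MeasureTheory.QuasiMeasurePreserving.prodMap ⟨measurable_const_mul _, by
        rw [Real.map_volume_mul_left hc2.ne']; exact Measure.smul_absolutelyContinuous⟩ hq₁
    have hslice : ∀ t < 0, (fun x => c • R.symm (w (c ^ 2 * t) (c • R x))) =ᵐ[volume] w t := by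
      intro t ht
      have h1 : ∀ᵐ x ∂(volume : Measure (EuclideanSpace ℝ (Fin 3))), w (c ^ 2 * t) (c • R x) = u (c ^ 2 * t) (c • R x) :=
        hq₁.ae (hwu _ (mul_neg_of_pos_of_neg hc2 ht))
      filter_upwards [h1, hwu t ht] with x hx hx'
      rw [hx, hdss t x, hx']
    have hjoint : ∀ᵐ z ∂(volume.restrict (Iio (0 : ℝ) ×ˢ (univ : Set (EuclideanSpace ℝ (Fin 3))))),
        c • R.symm (w (c ^ 2 * z.1) (c • R z.2)) = w z.1 z.2 := by
      rw [Measure.volume_eq_prod, ← Measure.restrict_prod_eq_prod_univ]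
      have hm : StronglyMeasurable fun z : ℝ × (EuclideanSpace ℝ (Fin 3)) => c • R.symm (w (c ^ 2 * z.1) (c • R z.2)) :=
        (R.symm.continuous.comp_stronglyMeasurable (hsm.comp_measurable
          ((measurable_fst.const_mul _).prodMk
            ((R.continuous.measurable.comp measurable_snd).const_smul c)))).const_smul c
      exact ae_eq_prod_of_ae_slice_ae_eq hm.aestronglyMeasurable hsm.aestronglyMeasurable
        ((ae_restrict_mem measurableSet_Iio).mono fun t ht => hslice t ht)
    have hmaps : MapsTo (Prod.map (fun t : ℝ => c ^ 2 * t) (fun x : (EuclideanSpace ℝ (Fin 3)) => c • R x))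
        (Iio (0 : ℝ) ×ˢ (univ : Set (EuclideanSpace ℝ (Fin 3)))) (Iio 0 ×ˢ univ) := fun z hz =>
      ⟨by show c ^ 2 * z.1 < 0; exact mul_neg_of_pos_of_neg hc2 hz.1, mem_univ _⟩
    have hF : (fun z : ℝ × (EuclideanSpace ℝ (Fin 3)) => c • R.symm (V (c ^ 2 * z.1) (c • R z.2))) =ᵐ[
        volume.restrict (Iio (0 : ℝ) ×ˢ (univ : Set (EuclideanSpace ℝ (Fin 3))))] uncurry V := by
      filter_upwards [hae, csRepr_ae_comp hqΦ hS hS hmaps hae, hjoint] with z h1 h2 h3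
      show c • R.symm (V (c ^ 2 * z.1) (c • R z.2)) = V z.1 z.2
      rw [← show w (c ^ 2 * z.1) (c • R z.2) = V (c ^ 2 * z.1) (c • R z.2) from h2, h3]
      exact h1
    have hΦc : Continuous (Prod.map (fun t : ℝ => c ^ 2 * t) (fun x : (EuclideanSpace ℝ (Fin 3)) => c • R x)) :=
      (continuous_const.mul continuous_id).prodMap (R.continuous.const_smul c)
    have hEq := Measure.eqOn_open_of_ae_eq hF (isOpen_Iio.prod isOpen_univ)
      ((R.symm.continuous.comp_continuousOn (hcont.comp hΦc.continuousOn hmaps)).const_smul c)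
      hcont
    intro t x
    rcases lt_or_ge t 0 with ht | ht
    · exact hEq (x := (t, x)) ⟨ht, mem_univ _⟩
    · rw [hV0 t ht x, hV0 (c ^ 2 * t) (mul_nonneg hc2.le ht) (c • R x), map_zero, smul_zero]
  -- ## Step 5: the slice-wise link `V t = u t` a.e. for EVERY `t < 0`
  have h1 : ∀ᵐ t ∂(volume.restrict (Iio (0 : ℝ))), V t =ᵐ[volume] u t := by
    rw [Measure.volume_eq_prod, ← Measure.restrict_prod_eq_prod_univ] at hae
    filter_upwards [Measure.ae_ae_of_ae_prod hae, ae_restrict_mem measurableSet_Iio] with t ht ht0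
    filter_upwards [ht, hwu t ht0] with x hx hx'
    rw [← hx', show w t x = V t x from hx]
  have hwsV := fun θ hθ => csRepr_weakStar hT.isAncientMildSolution
    (fun t ht => hT.aestronglyMeasurable_slice ht) hdec (θ := θ) hθ
  refine ⟨V, hT, hR, hdec, fun t ht => ?_, hV0⟩
  have hlocu : LocallyIntegrable (u t) volume :=
    (memLp_top_of_bound (hmeas t ht) (C₀ / √(-t))
      (Eventually.of_forall fun x => hC.hasTypeITimeDecay hC₀ t ht x)).locallyIntegrable le_top
  have hlocV : LocallyIntegrable (V t) volume :=
    (memLp_top_of_bound (hT.aestronglyMeasurable_slice ht) (C₀ / √(-t))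
      (Eventually.of_forall fun x => hdec.hasTypeITimeDecay hC₀ t ht x)).locallyIntegrable le_top
  have hzero : (fun x => V t x - u t x) =ᵐ[volume] (0 : (EuclideanSpace ℝ (Fin 3)) → (EuclideanSpace ℝ (Fin 3))) := by
    refine FunctionSpaces.ae_eq_zero_of_forall_integral_inner_test_eq_zero (hlocV.sub hlocu)
      fun θ hθ => ?_
    have hiV : Integrable (fun x => ⟪V t x, θ x⟫) volume :=
      integrable_inner_of_continuous_of_hasCompactSupport (hT.continuous_slice ht)
        hθ.contDiff.continuous hθ.hasCompactSupport
    have hiu : Integrable (fun x => ⟪u t x, θ x⟫) volume :=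
      integrable_inner_of_norm_le_of_hasCompactSupport (hmeas t ht)
        (fun x => hC.hasTypeITimeDecay hC₀ t ht x) hθ.contDiff.continuous hθ.hasCompactSupport
    have hg : (fun s => ∫ x, ⟪V s x, θ x⟫) =ᵐ[volume.restrict (Iio (0 : ℝ))]
        fun s => ∫ x, ⟪u s x, θ x⟫ := by
      filter_upwards [h1] with s hs
      exact integral_congr_ae (hs.mono fun x hx => by simp only [hx])
    have heq := Measure.eqOn_open_of_ae_eq hg isOpen_Iio (hwsV θ hθ) (hws θ hθ) ht
    rw [show (fun x => ⟪V t x - u t x, θ x⟫) = fun x => ⟪V t x, θ x⟫ - ⟪u t x, θ x⟫ from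
      funext fun x => inner_sub_left _ _ _, integral_sub hiV hiu]
    exact sub_eq_zero.2 heq
  filter_upwards [hzero] with x hx
  exact sub_eq_zero.1 hx

end Summit.NavierStokesRegularity.NavierStokesRegularity.Theorems.CorkscrewProfile.Birth

end
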